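import Literature.AlgebraicGeometry.HodgeTheory.WeilClassesFieldGeneratorChange
import Literature.AlgebraicGeometry.Motives.AbelianVarietyIsogenyCovering
import Literature.AlgebraicGeometry.Motives.AbelianVarietyEndGaloisFinite
import HarnessLib

/-!
# Ring 2 / AbelianAll — dividing a Weil-type endomorphism by `m` along an isogeny

research route, not a corollary; conditional on HC_CM plus one named minimal statement.
Cell line: research route conditional on HC_CM; not a corollary; Q11.4-sentence-2 already refuted in dim ≥ 3.
`HC_CM` (`Theses.RankFourFaces.CMAbelianHodge`) does not occur in this file; no case of the Hodge conjecture is claimed.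

Helper file of the publication unit `pub-hodge-ring2` (seat ab-weil-1, gen 4), supporting
`stmt-HodgeConjecture-16267`. Everything here is PROVED: it is the kernel infrastructure behind
`Ring2AbelianAllWeilSquarefree` (`WeilAlgebraicAll n d → WeilAlgebraicAll n (m²d)`, which re-indexes
the residual hypothesis of the Weil floor by squarefree `d`; research route, not a corollary).

* `weilClassesOf_zsmul_sq_mul` — for `ψ ∈ End B` with `ψ² = -d` (`d, m ≥ 1`) the Weil plane
  `E₊ ⊔ E₋ ⊆ H²ⁿ(B, ℂ)` of `(B, mψ, m²d)` IS that of `(B, ψ, d)`: both lines are `⋀²ⁿ` of the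
  `±i√d`-eigenspaces of the one field `ℚ(ψ) = ℚ(mψ) ⊂ End⁰ B` (Moonen–Zarhin 1998 §1: `W_K` is attached
  to `K`; the tree's `pullbackEigenclasses_pow_eq_of_eq_eval₂` with `P = X² + d`, `S = mX`).
* `map_mem_weilClassesOf_of_comm`, `map_zsmul_id_of_mem_weilClassesOf` — pull-back along an
  equivariant homomorphism preserves the Weil plane; `[m]^*` is `m²ⁿ` on it.
* `exists_isogeny_sq_descent` — **if `φ'² = -m²d` on `A` (`m ≥ 1`) there are an isogeny `p : A → B`,
  `f : B → A` with `f ∘ p = [m]_A`, and `ψ ∈ End B` with `ψ² = -d` and `f ∘ φ' = mψ ∘ f`** (on lattices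
  `B = V/(Λ + m⁻¹φ'Λ)`, `ψ = φ'/m`). In the tree: `S = φ'(A[m](ℂ)) ⊆ A[m](ℂ)` is finite, `B = A/S` is the
  quotient of Mumford §7 Thm. 4 (`AbelianVariety.quot`, with `f`, `f ∘ p = [m]`, kernel and surjectivity
  on `ℂ`-points from `AbelianVarietyIsogenyCovering`); `p ∘ φ'` kills `A[m]`, so `p ∘ φ' = m g`, and
  `g ∘ f` kills `B[m]`, so `g ∘ f = m ψ` (Milne 1986, Lemma 12.6 = `exists_eq_zsmul_of_forall_torsionPoints_self`);
  `ψ² = -d` and `f ∘ φ' = mψ ∘ f` then follow from torsion-freeness of `Hom` (Mumford §19 Thm. 3 =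
  `eq_zero_of_zsmul_eq_zero_of_cast_ne_zero`) and `p` epi (`IsIsogeny.cancel_left`).

## References

* D. Mumford, *Abelian Varieties* (1970), §7 Thm. 4 p. 72; §19 Thm. 3. [MumfordAV1970]
* J. S. Milne, *Abelian Varieties* (1986), Lemma 12.6. [Milne1986AbelianVarieties]
* B. Moonen, Yu. Zarhin, *Weil classes on abelian varieties*, Crelle 496 (1998), §1. [MoonenZarhin1998WeilClasses]
* B. van Geemen, *An introduction to the Hodge conjecture for abelian varieties* (1994), 4.8–4.9. [vanGeemen1994HodgeAV]
-/

noncomputable section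

set_option linter.dupNamespace false

open CategoryTheory Polynomial
open Literature.AlgebraicGeometry Literature.AlgebraicGeometry.Motives
open Literature.AlgebraicGeometry.HodgeTheory
open Literature.AlgebraicTopology.SingularHomology

namespace Summit.HodgeConjecture.HodgeConjecture.Ring2.AbelianAll

open scoped MonObj

/-! ### The Weil lines of `(B, mψ, m²d)` are those of `(B, ψ, d)` -/

/-- `X² + d` is irreducible over `ℚ` for `d ≥ 1` (no rational root). [folklore] -/
theorem irreducible_X_sq_add_natCast {d : ℕ} (hd : d ≠ 0) :
    Irreducible ((X ^ 2 + C (d : ℤ) : ℤ[X]).map (Int.castRingHom ℚ)) := by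
  have hmap : (X ^ 2 + C (d : ℤ) : ℤ[X]).map (Int.castRingHom ℚ) = X ^ 2 + C (d : ℚ) := by simp
  rw [hmap]
  have hdeg : (X ^ 2 + C (d : ℚ) : ℚ[X]).natDegree = 2 := natDegree_X_pow_add_C
  refine (irreducible_iff_roots_eq_zero_of_degree_le_three (by omega) (by omega)).mpr ?_
  refine Multiset.eq_zero_of_forall_notMem fun r hr ↦ ?_
  have hne : (X ^ 2 + C (d : ℚ) : ℚ[X]) ≠ 0 := (monic_X_pow_add_C (d : ℚ) two_ne_zero).ne_zero
  rw [mem_roots hne, IsRoot, eval_add, eval_pow, eval_X, eval_C] at hr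
  have hd' : (1 : ℚ) ≤ d := by exact_mod_cast Nat.one_le_iff_ne_zero.mpr hd
  nlinarith [sq_nonneg r]

section GeneratorChange

variable {B : AbelianVariety ℂ} {ψ : B ⟶ B} {m d : ℕ}

/-- `ψ² = -d` in `End B` means `P(ψ) = 0` for `P = X² + d ∈ ℤ[X]`. [folklore] -/
theorem eval₂_X_sq_add_eq_zero (hψ : ψ ≫ ψ = -(d • 𝟙 B)) :
    Polynomial.eval₂ (Int.castRingHom (CategoryTheory.End B)) (ψ : CategoryTheory.End B)
      (X ^ 2 + C (d : ℤ)) = 0 := by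
  rw [eval₂_add, eval₂_X_pow, eval₂_C, eq_intCast, Int.cast_natCast, pow_two, End.mul_def, hψ,
    ← Nat.smul_one_eq_cast, End.one_def]
  exact neg_add_cancel (d • 𝟙 B)

/-- `mψ = S(ψ)` for `S = m·X ∈ ℤ[X]`. [folklore] -/
theorem zsmul_eq_eval₂_C_mul_X :
    (((m : ℤ) • ψ : B ⟶ B) : CategoryTheory.End B) =
      Polynomial.eval₂ (Int.castRingHom (CategoryTheory.End B)) (ψ : CategoryTheory.End B)
        (C (m : ℤ) * X) := by
  rw [eval₂_mul_X, eval₂_C, eq_intCast, ← zsmul_eq_mul]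
  rfl

/-- `ρ ↦ mρ` is injective on the roots of `X² + d` (indeed on `ℂ`) for `m ≠ 0`. [folklore] -/
theorem eval₂_C_mul_X_injective (hm : m ≠ 0) (ρ ρ' : ℂ)
    (_h₁ : Polynomial.eval₂ (Int.castRingHom ℂ) ρ (X ^ 2 + C (d : ℤ)) = 0)
    (_h₂ : Polynomial.eval₂ (Int.castRingHom ℂ) ρ' (X ^ 2 + C (d : ℤ)) = 0)
    (h : Polynomial.eval₂ (Int.castRingHom ℂ) ρ (C (m : ℤ) * X) =
      Polynomial.eval₂ (Int.castRingHom ℂ) ρ' (C (m : ℤ) * X)) : ρ = ρ' := by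
  simp only [eval₂_mul_X, eval₂_C] at h
  simp only [eq_intCast, Int.cast_natCast] at h
  exact mul_left_cancel₀ (Nat.cast_ne_zero.mpr hm) h

/-- `±i√d` are roots of `X² + d`. [folklore] -/
theorem eval₂_X_sq_add_I_mul_sqrt (ε : ℂ) (hε : ε ^ 2 = 1) :
    Polynomial.eval₂ (Int.castRingHom ℂ) (ε * (Complex.I * (Real.sqrt d : ℂ))) (X ^ 2 + C (d : ℤ)) = 0 := by
  rw [eval₂_add, eval₂_X_pow, eval₂_C, eq_intCast, Int.cast_natCast, mul_pow, hε, one_mul, mul_pow,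
    Complex.I_sq, ← Complex.ofReal_pow, Real.sq_sqrt (Nat.cast_nonneg d)]
  push_cast
  ring

/-- `√(m²d) = m√d` in `ℂ`. [folklore] -/
theorem sqrt_sq_mul_natCast : (Real.sqrt ((m ^ 2 * d : ℕ) : ℝ) : ℂ) = (m : ℂ) * (Real.sqrt d : ℂ) := by
  rw [Nat.cast_mul, Nat.cast_pow, Real.sqrt_mul (by positivity), Real.sqrt_sq (Nat.cast_nonneg m)]
  push_cast
  ring

/-- **The Weil eigen-line `E_ε` of `(B, mψ, m²d)` is that of `(B, ψ, d)`** (`ε = ±1`): both are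
`⋀²ⁿ V_{ε i√d}`, the field `ℚ(ψ) = ℚ(mψ)` and the embedding being the same (Moonen–Zarhin: `W_K` is
attached to `K ⊂ End⁰`; the tree's `pullbackEigenclasses_pow_eq_of_eq_eval₂`).
[cite: MoonenZarhin1998WeilClasses, §1] -/
theorem pullbackEigenclasses_zsmul_sq_mul (hm : m ≠ 0) (hd : d ≠ 0) (hψ : ψ ≫ ψ = -(d • 𝟙 B))
    (ε : ℂ) (hε : ε ^ 2 = 1) (n : ℕ) :
    pullbackEigenclasses B ((m : ℤ) • ψ) (2 * n)
        (fun x y => ((x : ℂ) + (y : ℂ) * (ε * (Complex.I * (Real.sqrt ((m ^ 2 * d : ℕ) : ℝ) : ℂ)))) ^ (2 * n)) =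
      pullbackEigenclasses B ψ (2 * n)
        (fun x y => ((x : ℂ) + (y : ℂ) * (ε * (Complex.I * (Real.sqrt d : ℂ)))) ^ (2 * n)) := by
  have key := pullbackEigenclasses_pow_eq_of_eq_eval₂ (irreducible_X_sq_add_natCast hd)
    (eval₂_X_sq_add_eq_zero hψ) (zsmul_eq_eval₂_C_mul_X (m := m))
    (eval₂_C_mul_X_injective (d := d) hm) (eval₂_X_sq_add_I_mul_sqrt (d := d) ε hε) (2 * n)
  have hchar : (fun x y : ℕ => ((x : ℂ) + (y : ℂ) *
      (ε * (Complex.I * (Real.sqrt ((m ^ 2 * d : ℕ) : ℝ) : ℂ)))) ^ (2 * n)) =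
      fun x y : ℕ => ((x : ℂ) + (y : ℂ) * Polynomial.eval₂ (Int.castRingHom ℂ)
        (ε * (Complex.I * (Real.sqrt d : ℂ))) (C (m : ℤ) * X)) ^ (2 * n) := by
    funext x y
    rw [eval₂_mul_X, eval₂_C, eq_intCast, Int.cast_natCast, sqrt_sq_mul_natCast]
    ring
  rw [hchar, key]

/-- `E₊(B, mψ, m²d) = E₊(B, ψ, d)`. [cite: MoonenZarhin1998WeilClasses, §1] -/
theorem weilClassesPlus_zsmul_sq_mul (hm : m ≠ 0) (hd : d ≠ 0) (hψ : ψ ≫ ψ = -(d • 𝟙 B)) (n : ℕ) :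
    weilClassesPlus B ((m : ℤ) • ψ) n (m ^ 2 * d) = weilClassesPlus B ψ n d := by
  have h := pullbackEigenclasses_zsmul_sq_mul hm hd hψ 1 (one_pow 2) n
  have e₁ : (fun x y : ℕ => ((x : ℂ) + (y : ℂ) * Complex.I *
      (Real.sqrt ((m ^ 2 * d : ℕ) : ℝ) : ℂ)) ^ (2 * n)) = fun x y : ℕ => ((x : ℂ) + (y : ℂ) *
        (1 * (Complex.I * (Real.sqrt ((m ^ 2 * d : ℕ) : ℝ) : ℂ)))) ^ (2 * n) := by
    funext x y; ring
  have e₂ : (fun x y : ℕ => ((x : ℂ) + (y : ℂ) * Complex.I * (Real.sqrt d : ℂ)) ^ (2 * n)) =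
      fun x y : ℕ => ((x : ℂ) + (y : ℂ) * (1 * (Complex.I * (Real.sqrt d : ℂ)))) ^ (2 * n) := by
    funext x y; ring
  rw [weilClassesPlus, weilClassesPlus, e₁, e₂, h]

/-- `E₋(B, mψ, m²d) = E₋(B, ψ, d)`. [cite: MoonenZarhin1998WeilClasses, §1] -/
theorem weilClassesMinus_zsmul_sq_mul (hm : m ≠ 0) (hd : d ≠ 0) (hψ : ψ ≫ ψ = -(d • 𝟙 B)) (n : ℕ) :
    weilClassesMinus B ((m : ℤ) • ψ) n (m ^ 2 * d) = weilClassesMinus B ψ n d := by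
  have h := pullbackEigenclasses_zsmul_sq_mul hm hd hψ (-1) (by norm_num) n
  have e₁ : (fun x y : ℕ => ((x : ℂ) - (y : ℂ) * Complex.I *
      (Real.sqrt ((m ^ 2 * d : ℕ) : ℝ) : ℂ)) ^ (2 * n)) = fun x y : ℕ => ((x : ℂ) + (y : ℂ) *
        (-1 * (Complex.I * (Real.sqrt ((m ^ 2 * d : ℕ) : ℝ) : ℂ)))) ^ (2 * n) := by
    funext x y; ring
  have e₂ : (fun x y : ℕ => ((x : ℂ) - (y : ℂ) * Complex.I * (Real.sqrt d : ℂ)) ^ (2 * n)) =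
      fun x y : ℕ => ((x : ℂ) + (y : ℂ) * (-1 * (Complex.I * (Real.sqrt d : ℂ)))) ^ (2 * n) := by
    funext x y; ring
  rw [weilClassesMinus, weilClassesMinus, e₁, e₂, h]

/-- `E₊ ⊔ E₋` of `(B, mψ, m²d)` is that of `(B, ψ, d)`. [cite: MoonenZarhin1998WeilClasses, §1] -/
theorem weilClassesOf_zsmul_sq_mul (hm : m ≠ 0) (hd : d ≠ 0) (hψ : ψ ≫ ψ = -(d • 𝟙 B)) (n : ℕ) :
    weilClassesOf B ((m : ℤ) • ψ) n (m ^ 2 * d) = weilClassesOf B ψ n d := by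
  rw [weilClassesOf, weilClassesOf, weilClassesPlus_zsmul_sq_mul hm hd hψ,
    weilClassesMinus_zsmul_sq_mul hm hd hψ]

end GeneratorChange

/-! ### Pull-back along an equivariant homomorphism -/

/-- `u^* (v^* c) = (u ≫ v)^* c` for homomorphisms `u : A → B`, `v : B → C` of abelian varieties. [folklore] -/
theorem map_map_apply_of_hom {A B C : AbelianVariety ℂ} (u : A ⟶ B) (v : B ⟶ C) {k : ℕ}
    (c : complexBetti C.X k) :
    singularCohomology.map ℂ ℂ (Motives.AlgPoints.mapContinuous (L := ℂ) u.hom.hom.hom) k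
        (singularCohomology.map ℂ ℂ (Motives.AlgPoints.mapContinuous (L := ℂ) v.hom.hom.hom) k c) =
      singularCohomology.map ℂ ℂ (Motives.AlgPoints.mapContinuous (L := ℂ) (u ≫ v).hom.hom.hom) k c := by
  change _ = singularCohomology.map ℂ ℂ
    (Motives.AlgPoints.mapContinuous (L := ℂ) (u.hom.hom.hom ≫ v.hom.hom.hom)) k c
  rw [Motives.AlgPoints.mapContinuous_comp, singularCohomology.map_comp]
  rfl

/-- **Pull-back along an equivariant homomorphism maps eigenclasses to eigenclasses**: for
`u : B → A` with `u ≫ φ_A = φ_B ≫ u`, `u^*` maps the `χ`-eigenclasses of `(A, φ_A)` to those of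
`(B, φ_B)` (`u` intertwines every `x·𝟙 + y·φ`). [cite: vanGeemen1994HodgeAV, 4.8–4.9] -/
theorem map_mem_pullbackEigenclasses_of_comm {A B : AbelianVariety ℂ} {φA : A ⟶ A} {φB : B ⟶ B}
    (u : B ⟶ A) (hu : u ≫ φA = φB ≫ u) {k : ℕ} {χ : ℕ → ℕ → ℂ} {c : complexBetti A.X k}
    (hc : c ∈ pullbackEigenclasses A φA k χ) :
    singularCohomology.map ℂ ℂ (Motives.AlgPoints.mapContinuous (L := ℂ) u.hom.hom.hom) k c ∈
      pullbackEigenclasses B φB k χ := by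
  rw [mem_pullbackEigenclasses_iff] at hc ⊢
  intro x y
  have hcomm : (x • 𝟙 B + y • φB) ≫ u = u ≫ (x • 𝟙 A + y • φA) := by
    simp [Preadditive.add_comp, Preadditive.comp_add, hu]
  rw [map_map_apply_of_hom, hcomm, ← map_map_apply_of_hom, hc x y, map_smul]

/-- The same for the Weil plane: `u^* (E₊ ⊔ E₋)(A, φ_A, d) ⊆ (E₊ ⊔ E₋)(B, φ_B, d)`.
[cite: vanGeemen1994HodgeAV, 4.8–4.9] -/
theorem map_mem_weilClassesOf_of_comm {A B : AbelianVariety ℂ} {φA : A ⟶ A} {φB : B ⟶ B}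
    (u : B ⟶ A) (hu : u ≫ φA = φB ≫ u) {n d : ℕ} {c : complexBetti A.X (2 * n)}
    (hc : c ∈ weilClassesOf A φA n d) :
    singularCohomology.map ℂ ℂ (Motives.AlgPoints.mapContinuous (L := ℂ) u.hom.hom.hom) (2 * n) c ∈
      weilClassesOf B φB n d := by
  rw [weilClassesOf, Submodule.mem_sup] at hc ⊢
  obtain ⟨c₁, h₁, c₂, h₂, rfl⟩ := hc
  exact ⟨_, map_mem_pullbackEigenclasses_of_comm u hu h₁, _,
    map_mem_pullbackEigenclasses_of_comm u hu h₂, (map_add _ _ _).symm⟩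


/-- **`[m]^*` is `m²ⁿ` on the Weil plane** `E₊ ⊔ E₋ ⊆ H²ⁿ`: both lines are `(x·𝟙 + y·φ)`-eigen with
characters `(x ± y i√d)²ⁿ`, evaluated at `(x, y) = (m, 0)`. [cite: vanGeemen1994HodgeAV, 4.8–4.9] -/
theorem map_zsmul_id_of_mem_weilClassesOf {A : AbelianVariety ℂ} {φ : A ⟶ A} {n d : ℕ} (m : ℕ)
    {c : complexBetti A.X (2 * n)} (hc : c ∈ weilClassesOf A φ n d) :
    singularCohomology.map ℂ ℂ
        (Motives.AlgPoints.mapContinuous (L := ℂ) ((m : ℤ) • 𝟙 A : A ⟶ A).hom.hom.hom) (2 * n) c =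
      ((m : ℂ) ^ (2 * n)) • c := by
  have key : ∀ (χ : ℕ → ℕ → ℂ) (c : complexBetti A.X (2 * n)),
      c ∈ pullbackEigenclasses A φ (2 * n) χ →
      singularCohomology.map ℂ ℂ
        (Motives.AlgPoints.mapContinuous (L := ℂ) ((m : ℤ) • 𝟙 A : A ⟶ A).hom.hom.hom) (2 * n) c =
        χ m 0 • c := by
    intro χ c hc
    rw [mem_pullbackEigenclasses_iff] at hc
    have h := hc m 0
    rw [zero_nsmul, add_zero] at h
    rw [natCast_zsmul]
    exact h
  rw [weilClassesOf, Submodule.mem_sup] at hc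
  obtain ⟨c₁, h₁, c₂, h₂, rfl⟩ := hc
  rw [map_add, key _ c₁ h₁, key _ c₂ h₂, smul_add]
  congr 1 <;> simp

/-! ### The isogeny `A → B = A/φ'(A[m])` dividing `φ'` by `m` -/

section Descent

variable {A : AbelianVariety ℂ}

/-- On points, `(k • u)(P) = u(P)ᵏ`. [folklore] -/
theorem monoidHom_nsmul_apply {B : AbelianVariety ℂ} (k : ℕ) (u : A ⟶ B) (P : A.Points ℂ) :
    IsMonHom.monoidHom (k • u).hom.hom.hom (specOver ℂ ℂ) P =
      IsMonHom.monoidHom u.hom.hom.hom (specOver ℂ ℂ) P ^ k := by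
  simp only [IsMonHom.monoidHom_apply]
  rw [AbelianVariety.hom_nsmul, Grp.Hom.hom_pow, Mon.Hom.hom_pow, MonObj.comp_pow]

/-- On points, `(u + v)(P) = u(P) v(P)`. [folklore] -/
theorem monoidHom_add_apply {B : AbelianVariety ℂ} (u v : A ⟶ B) (P : A.Points ℂ) :
    IsMonHom.monoidHom (u + v).hom.hom.hom (specOver ℂ ℂ) P =
      IsMonHom.monoidHom u.hom.hom.hom (specOver ℂ ℂ) P *
        IsMonHom.monoidHom v.hom.hom.hom (specOver ℂ ℂ) P := by
  simp only [IsMonHom.monoidHom_apply]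
  rw [AbelianVariety.hom_hom_hom_add, MonObj.comp_mul]

/-- On points, `0(P) = 1`. [folklore] -/
theorem monoidHom_zero_apply {B : AbelianVariety ℂ} (P : A.Points ℂ) :
    IsMonHom.monoidHom (0 : A ⟶ B).hom.hom.hom (specOver ℂ ℂ) P = 1 := by
  simp only [IsMonHom.monoidHom_apply]
  rw [AbelianVariety.hom_zero, Grp.Hom.hom_one, Mon.Hom.hom_one, MonObj.comp_one]

/-- `Hom(A, B)` has no `m`-torsion (`m ≥ 1`, characteristic `0`): `m u = m v → u = v` (Mumford §19
Thm. 3; the tree's `eq_zero_of_zsmul_eq_zero_of_cast_ne_zero`). [cite: MumfordAV1970, §19 Thm. 3] -/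
theorem zsmul_left_cancel {B : AbelianVariety ℂ} {m : ℕ} (hm : m ≠ 0) {u v : A ⟶ B}
    (h : (m : ℤ) • u = (m : ℤ) • v) : u = v :=
  sub_eq_zero.mp (AbelianVariety.eq_zero_of_zsmul_eq_zero_of_cast_ne_zero (n := (m : ℤ))
    (by exact_mod_cast hm) (by rw [smul_sub, h, sub_self]))

/-- **Dividing `φ'` by `m` on a quotient.** Let `φ'² = -m²d` on `A` (`m ≥ 1`) and let `p : A → B` be an
isogeny with `f ∘ p = [m]`, `Ker p(ℂ) = φ'(A[m](ℂ))` and `p(ℂ)` onto. Then there is `ψ ∈ End B` with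
`ψ² = -d` and `f ∘ φ' = mψ ∘ f` (`ψ = φ'/m` on `B = V/(Λ + m⁻¹φ'Λ)`). Proof: `p ∘ φ'` kills `A[m]`, so
`p ∘ φ' = m g` (Milne 12.6); `g ∘ f` kills `B[m]`, so `g ∘ f = m ψ`; the identities follow from
torsion-freeness of `Hom`. [cite: Milne1986AbelianVarieties, Lemma 12.6 (PDF p. 191)] -/
theorem exists_sq_eq_of_quotient {m d : ℕ} (hm : m ≠ 0) {φ' : A ⟶ A}
    (hφ' : φ' ≫ φ' = -((m ^ 2 * d) • 𝟙 A)) {B : AbelianVariety ℂ} (p : A ⟶ B) (f : B ⟶ A)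
    (hp : AbelianVariety.IsIsogeny p) (hf : p ≫ f = (m : ℤ) • 𝟙 A)
    (hker : (IsMonHom.monoidHom p.hom.hom.hom (specOver ℂ ℂ)).ker =
      (A.torsionPoints ℂ m).map (IsMonHom.monoidHom φ'.hom.hom.hom (specOver ℂ ℂ)))
    (hsurj : Function.Surjective (IsMonHom.monoidHom p.hom.hom.hom (specOver ℂ ℂ))) :
    ∃ ψ : B ⟶ B, ψ ≫ ψ = -(d • 𝟙 B) ∧ f ≫ φ' = ((m : ℤ) • ψ) ≫ f := by
  have hmC : ((m : ℤ) : ℂ) ≠ 0 := by exact_mod_cast hm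
  -- `p ∘ φ'` kills `A[m]`, hence `φ' ≫ p = m • g`
  obtain ⟨g, hg⟩ := AbelianVariety.exists_eq_zsmul_of_forall_torsionPoints_self (m : ℤ) hmC
    (φ' ≫ p) fun Q hQ => by
      show IsMonHom.monoidHom (φ' ≫ p).hom.hom.hom (specOver ℂ ℂ) Q = 1
      rw [AbelianVariety.monoidHom_comp_apply, ← MonoidHom.mem_ker, hker]
      exact Subgroup.mem_map_of_mem _ hQ
  -- `f ≫ p = [m]_B`, `g ≫ f = φ'`, `φ' ≫ g = -(md) p`
  have hfp : f ≫ p = (m : ℤ) • 𝟙 B := hp.cancel_left (by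
    rw [← Category.assoc, hf, Preadditive.zsmul_comp, Preadditive.comp_zsmul, Category.id_comp,
      Category.comp_id])
  have hgf : g ≫ f = φ' := zsmul_left_cancel hm (by
    rw [← Preadditive.zsmul_comp, ← hg, Category.assoc, hf, Preadditive.comp_zsmul, Category.comp_id])
  have hφg : φ' ≫ g + (m * d) • p = 0 := by
    refine AbelianVariety.eq_zero_of_zsmul_eq_zero_of_cast_ne_zero hmC ?_
    rw [smul_add, ← Preadditive.comp_zsmul, ← hg, ← Category.assoc, hφ', Preadditive.neg_comp,
      Preadditive.nsmul_comp, Category.id_comp, natCast_zsmul, smul_smul,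
      show m * (m * d) = m ^ 2 * d by ring, neg_add_cancel]
  -- `g ∘ f` kills `B[m]`, hence `f ≫ g = m • ψ`
  obtain ⟨ψ, hψ⟩ := AbelianVariety.exists_eq_zsmul_of_forall_torsionPoints_self (m : ℤ) hmC
    (f ≫ g) fun Q hQ => by
      rw [AbelianVariety.mem_torsionPoints_iff] at hQ
      obtain ⟨P, rfl⟩ := hsurj Q
      have hPm : P ^ (m : ℤ) ∈ (IsMonHom.monoidHom p.hom.hom.hom (specOver ℂ ℂ)).ker := by
        rw [MonoidHom.mem_ker, map_zpow, hQ]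
      rw [hker] at hPm
      obtain ⟨x, hx, hxP⟩ := Subgroup.mem_map.mp hPm
      rw [AbelianVariety.mem_torsionPoints_iff] at hx
      have hx1 : IsMonHom.monoidHom (φ' ≫ g).hom.hom.hom (specOver ℂ ℂ) x = 1 := by
        have h0 := congrArg (fun u : A ⟶ B => IsMonHom.monoidHom u.hom.hom.hom (specOver ℂ ℂ) x) hφg
        dsimp only at h0
        rw [monoidHom_add_apply, monoidHom_zero_apply, monoidHom_nsmul_apply, pow_mul,
          ← zpow_natCast _ m, ← map_zpow, hx, map_one, one_pow, mul_one] at h0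
        exact h0
      show IsMonHom.monoidHom (f ≫ g).hom.hom.hom (specOver ℂ ℂ)
        (IsMonHom.monoidHom p.hom.hom.hom (specOver ℂ ℂ) P) = 1
      rw [AbelianVariety.monoidHom_comp_apply, ← AbelianVariety.monoidHom_comp_apply A p f P, hf,
        AbelianVariety.monoidHom_zsmul_id_apply, ← zpow_natCast, ← hxP,
        ← AbelianVariety.monoidHom_comp_apply, hx1]
  -- `ψ² = -d` and `f ∘ φ' = mψ ∘ f`
  have hφg' : φ' ≫ g = -((m * d) • p) := eq_neg_of_add_eq_zero_left hφg
  refine ⟨ψ, zsmul_left_cancel hm (zsmul_left_cancel hm ?_), by rw [← hψ, Category.assoc, hgf]⟩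
  rw [← Preadditive.comp_zsmul ψ, ← Preadditive.zsmul_comp, ← hψ, Category.assoc,
    ← Category.assoc g f g, hgf, hφg', Preadditive.comp_neg, Preadditive.comp_nsmul, hfp]
  simp only [natCast_zsmul, smul_neg, smul_smul, neg_inj]
  congr 1
  ring

/-- **The isogeny dividing `φ'` by `m`.** If `φ'² = -m²d` on `A` (`m ≥ 1`), there are an isogeny
`p : A → B`, a homomorphism `f : B → A` with `f ∘ p = [m]_A`, and `ψ ∈ End B` with `ψ² = -d` and
`f ∘ φ' = mψ ∘ f`: `B = A/φ'(A[m])` (Mumford §7 Thm. 4, the tree's `AbelianVariety.quot`).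
[cite: MumfordAV1970, §7 Thm. 4 p. 72] -/
theorem exists_isogeny_sq_descent {m d : ℕ} (hm : m ≠ 0) {φ' : A ⟶ A}
    (hφ' : φ' ≫ φ' = -((m ^ 2 * d) • 𝟙 A)) :
    ∃ (B : AbelianVariety ℂ) (p : A ⟶ B) (f : B ⟶ A) (ψ : B ⟶ B), AbelianVariety.IsIsogeny p ∧
      p ≫ f = (m : ℤ) • 𝟙 A ∧ ψ ≫ ψ = -(d • 𝟙 B) ∧ f ≫ φ' = ((m : ℤ) • ψ) ≫ f := by
  set S : Subgroup (A.Points ℂ) :=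
    (A.torsionPoints ℂ m).map (IsMonHom.monoidHom φ'.hom.hom.hom (specOver ℂ ℂ)) with hSdef
  have hS : S ≤ A.torsionPoints ℂ m := by
    rintro _ ⟨x, hx, rfl⟩
    have hx' : x ^ (m : ℤ) = 1 := (AbelianVariety.mem_torsionPoints_iff _ _).mp hx
    show _ ∈ A.torsionPoints ℂ m
    rw [AbelianVariety.mem_torsionPoints_iff, ← map_zpow, hx', map_one]
  haveI : Finite S := A.finite_of_le_torsionPoints hm hS
  haveI : AlgebraicGeometry.IsFinite (AbelianVariety.Hom.toSchemeHom ((m : ℤ) • 𝟙 A)) :=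
    A.isFinite_toSchemeHom_zsmul_id hm
  haveI : AlgebraicGeometry.IsAffineHom (AbelianVariety.Hom.toSchemeHom ((m : ℤ) • 𝟙 A)) :=
    inferInstance
  obtain ⟨f, hf⟩ := A.exists_quotHom_comp_eq_zsmul_id hm S hS
  obtain ⟨ψ, hψ, hfφ⟩ := exists_sq_eq_of_quotient hm hφ' _ f (A.isIsogeny_quotHom ℂ S _ _ _ _) hf
    (A.ker_monoidHom_quotHom hm S hS) (A.surjective_monoidHom_quotHom hm S hS)
  exact ⟨_, _, f, ψ, A.isIsogeny_quotHom ℂ S _ _ _ _, hf, hψ, hfφ⟩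

end Descent

end Summit.HodgeConjecture.HodgeConjecture.Ring2.AbelianAll

end
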